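import Literature.Barriers.NavierStokesRegularity.CheapNavierStokesBlowup
import Literature.Analysis.FluidPDE.FourierL2Convolution
import Literature.Analysis.FluidPDE.FourierL2Duhamel
import Literature.Analysis.FunctionSpaces.SobolevProductLawFourier
import Mathlib.MeasureTheory.Integral.Prod
import HarnessLib

/-!
# Cheap Navier–Stokes on the Fourier side: the `L^∞_t H¹ ∩ L²_t H²` bilinear estimate

Support file for the discharge of `CheapNSFourierNonnegPersistence`
(`CheapNavierStokesBlowupProofs.lean`), i.e. of the first step of the proof of
Lemarié-Rieusset 2016, Thm. 11.1 (p. 314): the local `H¹` theory (Prop. 11.1, pp. 310–312) of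
the cheap equation `∂ₜu = νΔu + √(-Δ)(u²)` written on the Fourier side, in the weighted-`L²`
class of the barrier `CheapNavierStokesBlowup`.

For jointly measurable trajectories `F, G : ℝ → ℝ³ → ℂ` (time, frequency) and a window
`[0, T]`, `0 < T ≤ 1`, the squared norms are

* `h1 F t = ∫ (1+|ξ|²) |F(t,ξ)|² dξ`, `h2 F t = ∫ (1+|ξ|²)² |F(t,ξ)|² dξ`,
* `qsup T F = sup_{t ∈ [0,T]} h1 F t`, `qint T F = ∫₀ᵀ h2 F t dt`, `qnorm = max qsup qint`
  (the square of the norm of `X_T = L^∞([0,T];H¹) ∩ L²((0,T);H²)` on the Fourier side),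

and the bilinear Duhamel term of the cheap equation is
`bilin ν T F G (t, ξ) = ∫₀^{t} e^{-ν(t-s)|ξ|²} |ξ| (F(s) ∗ G(s))(ξ) ds` (clamped time,
`FourierNS.clamp`, `FourierNS.heat`, `FourierNS.fconv` of the tree). The main results:

* `qnorm_bilin_le` — **the bilinear estimate**
  `qnorm T (bilin ν T F G) ≤ C_ν (vol B(0,L) · T + ε_L) · qnorm T F · qnorm T G` for every
  `L > 0`, with `ε_L = ∫_{|ξ| ≥ L} (1+|ξ|²)⁻² dξ` (`epsTail L`): the parabolic gain of one
  derivative (tree `FourierNS.enorm_duhamel_sq_le`, `FourierNS.lintegral_enorm_duhamel_sq_le`,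
  Tao's (energy-duh2) at fixed frequency), Peetre's inequality and Young `L² ∗ L¹ → L²` for the
  majorant convolution (tree `FourierL2Convolution`; `(a+b)² ≤ 2(a²+b²)` from `SobolevProductLawFourier`), and the splitting
  `‖f‖_{L¹} ≤ vol(B_L)^{1/2} ‖f‖_{L²(B_L)} + ε_L^{1/2} ‖(1+|ξ|²) f‖_{L²}` which produces the
  smallness for short windows without fractional interpolation;
* `qnorm_free_le` — the free evolution `e^{-νt|ξ|²} a(ξ)` has `qnorm ≤ max(2, 1/ν) ∫ (1+|ξ|²)|a|²`;
* measurability of all the objects for jointly measurable trajectories, and the elementary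
  algebra of `qnorm` (sums, a.e. modifications).

Everything is `ℝ≥0∞`-valued (lower integrals), as in the tree's weighted-`L²` Navier–Stokes
files (`FourierL2Duhamel*`), so that Tonelli applies unconditionally to measurable integrands.

## References

* P. G. Lemarié-Rieusset, *The Navier–Stokes Problem in the 21st Century*, CRC 2016, §11.2,
  Prop. 11.1 (pp. 310–312) and proof of Thm. 11.1 (p. 314); §7 (Thm. 7.2/7.3, the `H¹` theory).
  [`LemarieRieusset2016`]
* T. Tao, Anal. PDE 6 (2013), Lemma 2.1 (energy estimates for the Duhamel operator). [`Tao2011`]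
-/

noncomputable section

open MeasureTheory Set Filter Metric Real Function
open scoped ENNReal Topology Convolution

namespace Literature.Barriers.NavierStokesRegularity

open Literature.Analysis.FluidPDE.FourierNS
open Literature.Analysis.FunctionSpaces.FourierProductLaw (ennreal_add_sq_le_two_mul)

/-- Local notation for frequency space `ℝ³ = EuclideanSpace ℝ (Fin 3)`. -/
local notation "ℝ³" => EuclideanSpace ℝ (Fin 3)

namespace CheapNS

/-! ### The weight `w(ξ) = 1 + |ξ|²` -/

/-- The Sobolev weight `w(ξ) = 1 + |ξ|²` on the Fourier side, in `ℝ≥0∞`. [folklore] -/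
def wt (ξ : ℝ³) : ℝ≥0∞ := ENNReal.ofReal (1 + ‖ξ‖ ^ 2)

/-- Unfolding `wt`. [folklore] -/
theorem wt_apply (ξ : ℝ³) : wt ξ = ENNReal.ofReal (1 + ‖ξ‖ ^ 2) := rfl

/-- `1 ≤ w`. [folklore] -/
theorem one_le_wt (ξ : ℝ³) : 1 ≤ wt ξ := by
  rw [wt_apply, ← ENNReal.ofReal_one]
  exact ENNReal.ofReal_le_ofReal (by nlinarith [norm_nonneg ξ])

/-- `w < ∞`. [folklore] -/
theorem wt_ne_top (ξ : ℝ³) : wt ξ ≠ ∞ := ENNReal.ofReal_ne_top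

/-- `w ≠ 0`. [folklore] -/
theorem wt_ne_zero (ξ : ℝ³) : wt ξ ≠ 0 := (lt_of_lt_of_le zero_lt_one (one_le_wt ξ)).ne'

/-- `w` is measurable. [folklore] -/
theorem measurable_wt : Measurable wt :=
  (ENNReal.continuous_ofReal.comp (by fun_prop)).measurable

/-- `w ≤ (1 + |ξ|)²`. [folklore] -/
theorem wt_le_sq (ξ : ℝ³) : wt ξ ≤ ENNReal.ofReal ((1 + ‖ξ‖) ^ 1) ^ 2 := by
  rw [← ENNReal.ofReal_pow (by positivity), wt_apply]
  exact ENNReal.ofReal_le_ofReal (by nlinarith [norm_nonneg ξ])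

/-- `(1 + |ξ|)² ≤ 2 w`. [folklore] -/
theorem sq_le_two_mul_wt (ξ : ℝ³) : ENNReal.ofReal ((1 + ‖ξ‖) ^ 1) ^ 2 ≤ 2 * wt ξ := by
  calc ENNReal.ofReal ((1 + ‖ξ‖) ^ 1) ^ 2 = ENNReal.ofReal (((1 + ‖ξ‖) ^ 1) ^ 2) :=
        (ENNReal.ofReal_pow (by positivity) 2).symm
    _ ≤ ENNReal.ofReal (2 * (1 + ‖ξ‖ ^ 2)) :=
        ENNReal.ofReal_le_ofReal (by nlinarith [norm_nonneg ξ, sq_nonneg (1 - ‖ξ‖)])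
    _ = 2 * wt ξ := by rw [ENNReal.ofReal_mul (by norm_num), ENNReal.ofReal_ofNat, wt_apply]

/-- `w² ≤ 2 + 2|ξ|⁴`. [folklore] -/
theorem wt_sq_le (ξ : ℝ³) : wt ξ ^ 2 ≤ 2 + 2 * ENNReal.ofReal (‖ξ‖ ^ 4) := by
  calc wt ξ ^ 2 = ENNReal.ofReal ((1 + ‖ξ‖ ^ 2) ^ 2) := by
        rw [wt_apply, ENNReal.ofReal_pow (by positivity)]
    _ ≤ ENNReal.ofReal (2 + 2 * ‖ξ‖ ^ 4) :=
        ENNReal.ofReal_le_ofReal (by nlinarith [sq_nonneg (1 - ‖ξ‖ ^ 2)])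
    _ = 2 + 2 * ENNReal.ofReal (‖ξ‖ ^ 4) := by
        rw [ENNReal.ofReal_add (by norm_num) (by positivity), ENNReal.ofReal_mul (by norm_num),
          ENNReal.ofReal_ofNat]

/-! ### Squared norms of the class `L^∞_t H¹ ∩ L²_t H²` on the Fourier side -/

/-- `h1 F t = ∫ (1+|ξ|²) |F(t,ξ)|² dξ`, the squared `H¹` norm of the slice `F(t)`. [folklore] -/
def h1 (F : ℝ → ℝ³ → ℂ) (t : ℝ) : ℝ≥0∞ := ∫⁻ ξ, wt ξ * ‖F t ξ‖ₑ ^ 2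

/-- `h2 F t = ∫ (1+|ξ|²)² |F(t,ξ)|² dξ`, the squared `H²` norm of the slice `F(t)`. [folklore] -/
def h2 (F : ℝ → ℝ³ → ℂ) (t : ℝ) : ℝ≥0∞ := ∫⁻ ξ, wt ξ ^ 2 * ‖F t ξ‖ₑ ^ 2

/-- `qsup T F = sup_{t ∈ [0,T]} h1 F t` (squared `L^∞_t H¹` norm on the window). [folklore] -/
def qsup (T : ℝ) (F : ℝ → ℝ³ → ℂ) : ℝ≥0∞ := ⨆ t ∈ Icc (0 : ℝ) T, h1 F t

/-- `qint T F = ∫₀ᵀ h2 F t dt` (squared `L²_t H²` norm on the window). [folklore] -/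
def qint (T : ℝ) (F : ℝ → ℝ³ → ℂ) : ℝ≥0∞ := ∫⁻ t in Ioc 0 T, h2 F t

/-- `qnorm T F = max (qsup T F) (qint T F)`, the squared `X_T`-norm. [folklore] -/
def qnorm (T : ℝ) (F : ℝ → ℝ³ → ℂ) : ℝ≥0∞ := max (qsup T F) (qint T F)

/-- Unfolding `h1`. [folklore] -/
theorem h1_apply (F : ℝ → ℝ³ → ℂ) (t : ℝ) : h1 F t = ∫⁻ ξ, wt ξ * ‖F t ξ‖ₑ ^ 2 := rfl

/-- Unfolding `h2`. [folklore] -/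
theorem h2_apply (F : ℝ → ℝ³ → ℂ) (t : ℝ) : h2 F t = ∫⁻ ξ, wt ξ ^ 2 * ‖F t ξ‖ₑ ^ 2 := rfl

/-- Unfolding `qint`. [folklore] -/
theorem qint_apply (T : ℝ) (F : ℝ → ℝ³ → ℂ) : qint T F = ∫⁻ t in Ioc 0 T, h2 F t := rfl

/-- Unfolding `qnorm`. [folklore] -/
theorem qnorm_apply (T : ℝ) (F : ℝ → ℝ³ → ℂ) : qnorm T F = max (qsup T F) (qint T F) := rfl

/-- `h1 F t ≤ qsup T F` for `t ∈ [0,T]`. [folklore] -/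
theorem h1_le_qsup {T : ℝ} (F : ℝ → ℝ³ → ℂ) {t : ℝ} (ht : t ∈ Icc (0 : ℝ) T) :
    h1 F t ≤ qsup T F :=
  le_iSup₂ (f := fun t (_ : t ∈ Icc (0 : ℝ) T) => h1 F t) t ht

/-- `qsup T F ≤ A ↔ ∀ t ∈ [0,T], h1 F t ≤ A`. [folklore] -/
theorem qsup_le_iff {T : ℝ} {F : ℝ → ℝ³ → ℂ} {A : ℝ≥0∞} :
    qsup T F ≤ A ↔ ∀ t ∈ Icc (0 : ℝ) T, h1 F t ≤ A :=
  iSup₂_le_iff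

/-- `qsup ≤ qnorm`. [folklore] -/
theorem qsup_le_qnorm (T : ℝ) (F : ℝ → ℝ³ → ℂ) : qsup T F ≤ qnorm T F := le_max_left _ _

/-- `qint ≤ qnorm`. [folklore] -/
theorem qint_le_qnorm (T : ℝ) (F : ℝ → ℝ³ → ℂ) : qint T F ≤ qnorm T F := le_max_right _ _

/-- `h1 F t ≤ qnorm T F` for `t ∈ [0,T]`. [folklore] -/
theorem h1_le_qnorm {T : ℝ} (F : ℝ → ℝ³ → ℂ) {t : ℝ} (ht : t ∈ Icc (0 : ℝ) T) :
    h1 F t ≤ qnorm T F :=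
  (h1_le_qsup F ht).trans (qsup_le_qnorm T F)

/-- The plain `L²` mass of a slice is at most `h1`. [folklore] -/
theorem lintegral_enorm_sq_le_h1 (F : ℝ → ℝ³ → ℂ) (t : ℝ) : ∫⁻ ξ, ‖F t ξ‖ₑ ^ 2 ≤ h1 F t :=
  lintegral_mono fun ξ => by
    calc ‖F t ξ‖ₑ ^ 2 = 1 * ‖F t ξ‖ₑ ^ 2 := (one_mul _).symm
      _ ≤ wt ξ * ‖F t ξ‖ₑ ^ 2 := mul_le_mul' (one_le_wt ξ) le_rfl

/-- `h1 ≤ h2`. [folklore] -/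
theorem h1_le_h2 (F : ℝ → ℝ³ → ℂ) (t : ℝ) : h1 F t ≤ h2 F t :=
  lintegral_mono fun ξ => by
    calc wt ξ * ‖F t ξ‖ₑ ^ 2 = wt ξ * 1 * ‖F t ξ‖ₑ ^ 2 := by rw [mul_one]
      _ ≤ wt ξ * wt ξ * ‖F t ξ‖ₑ ^ 2 := by gcongr; exact one_le_wt ξ
      _ = wt ξ ^ 2 * ‖F t ξ‖ₑ ^ 2 := by ring

/-! ### The objects: nonlinearity, bilinear Duhamel term, free evolution -/

/-- The Fourier-side cheap nonlinearity of two slices: `|ξ| (F(s) ∗ G(s))(ξ)`. [folklore] -/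
def nl (F G : ℝ → ℝ³ → ℂ) (s : ℝ) (ξ : ℝ³) : ℂ := ((‖ξ‖ : ℝ) : ℂ) * fconv (F s) (G s) ξ

/-- The bilinear Duhamel term of the cheap equation on the window `[0, T]` (clamped time):
`bilin ν T F G (t, ξ) = ∫₀^{τ} e^{-ν(τ-s)|ξ|²} |ξ| (F(s) ∗ G(s))(ξ) ds`, `τ = clamp T t`.
[folklore] -/
def bilin (ν T : ℝ) (F G : ℝ → ℝ³ → ℂ) (t : ℝ) (ξ : ℝ³) : ℂ :=
  ∫ s in (0 : ℝ)..clamp T t, heat ν ξ (clamp T t - s) • nl F G s ξ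

/-- The free evolution `e^{-ν τ |ξ|²} a(ξ)`, `τ = clamp T t`. [folklore] -/
def free (ν T : ℝ) (a : ℝ³ → ℂ) (t : ℝ) (ξ : ℝ³) : ℂ := ((heat ν ξ (clamp T t) : ℝ) : ℂ) * a ξ

/-- The majorant of the nonlinearity: `maj F G s ξ = (|F(s)| ⋆ₗ |G(s)|)(ξ)`. [folklore] -/
def maj (F G : ℝ → ℝ³ → ℂ) (s : ℝ) (ξ : ℝ³) : ℝ≥0∞ :=
  ((fun η => ‖F s η‖ₑ) ⋆ₗ (fun η => ‖G s η‖ₑ)) ξ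

/-- Unfolding `bilin` on the window. [folklore] -/
theorem bilin_of_mem {ν T : ℝ} (F G : ℝ → ℝ³ → ℂ) {t : ℝ} (ht : t ∈ Icc (0 : ℝ) T) (ξ : ℝ³) :
    bilin ν T F G t ξ = ∫ s in (0 : ℝ)..t, heat ν ξ (t - s) • nl F G s ξ := by
  rw [bilin, clamp_of_mem ht]

/-- Unfolding `free` on the window. [folklore] -/
theorem free_of_mem {ν T : ℝ} (a : ℝ³ → ℂ) {t : ℝ} (ht : t ∈ Icc (0 : ℝ) T) (ξ : ℝ³) :
    free ν T a t ξ = ((heat ν ξ t : ℝ) : ℂ) * a ξ := by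
  rw [free, clamp_of_mem ht]

/-- **The nonlinearity is dominated by the majorant**: `‖|ξ|(F ∗ G)(ξ)‖ ≤ |ξ| (|F| ⋆ₗ |G|)(ξ)`.
[folklore] -/
theorem enorm_nl_le (F G : ℝ → ℝ³ → ℂ) (s : ℝ) (ξ : ℝ³) :
    ‖nl F G s ξ‖ₑ ≤ ENNReal.ofReal ‖ξ‖ * maj F G s ξ := by
  rw [nl, enorm_mul, maj]
  refine mul_le_mul' (le_of_eq ?_) (enorm_fconv_le_lconv _ _ ξ)
  rw [← ofReal_norm, Complex.norm_real, Real.norm_of_nonneg (norm_nonneg _)]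

/-! ### Measurability for jointly measurable trajectories -/

section Measurability

variable {F G : ℝ → ℝ³ → ℂ}

/-- Slices in frequency of a jointly measurable trajectory are measurable. [folklore] -/
theorem measurable_slice (hF : Measurable (uncurry F)) (t : ℝ) : Measurable (F t) :=
  hF.comp (measurable_const.prodMk measurable_id)

/-- Slices in time of a jointly measurable trajectory are measurable. [folklore] -/
theorem measurable_tslice (hF : Measurable (uncurry F)) (ξ : ℝ³) : Measurable fun s => F s ξ :=
  hF.comp (measurable_id.prodMk measurable_const)

/-- **Joint measurability of the frequency convolution of two trajectories**:
`(s, ξ) ↦ (F(s) ∗ G(s))(ξ)` is measurable (Fubini measurability of a parametric Bochner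
integral). [folklore] -/
theorem measurable_fconv_uncurry (hF : Measurable (uncurry F)) (hG : Measurable (uncurry G)) :
    Measurable fun p : ℝ × ℝ³ => fconv (F p.1) (G p.1) p.2 := by
  have h : Measurable fun q : (ℝ × ℝ³) × ℝ³ => F q.1.1 q.2 * G q.1.1 (q.1.2 - q.2) := by
    refine Measurable.mul ?_ ?_
    · exact hF.comp (measurable_fst.fst.prodMk measurable_snd)
    · exact hG.comp (measurable_fst.fst.prodMk (measurable_fst.snd.sub measurable_snd))
  have h2 := (h.stronglyMeasurable.integral_prod_right' (ν := (volume : Measure ℝ³))).measurable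
  have heq : (fun p : ℝ × ℝ³ => fconv (F p.1) (G p.1) p.2) =
      fun x : ℝ × ℝ³ => ∫ y, F x.1 y * G x.1 (x.2 - y) := by
    funext p; simp only [fconv_apply]
  rw [heq]
  exact h2

/-- Joint measurability of the majorant convolution of two trajectories. [folklore] -/
theorem measurable_lconv_uncurry {Φ Ψ : ℝ → ℝ³ → ℝ≥0∞} (hΦ : Measurable (uncurry Φ))
    (hΨ : Measurable (uncurry Ψ)) : Measurable fun p : ℝ × ℝ³ => (Φ p.1 ⋆ₗ Ψ p.1) p.2 := by
  have h : Measurable fun q : (ℝ × ℝ³) × ℝ³ => Φ q.1.1 q.2 * Ψ q.1.1 (q.1.2 - q.2) := by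
    refine Measurable.mul ?_ ?_
    · exact hΦ.comp (measurable_fst.fst.prodMk measurable_snd)
    · exact hΨ.comp (measurable_fst.fst.prodMk (measurable_fst.snd.sub measurable_snd))
  have heq : (fun p : ℝ × ℝ³ => (Φ p.1 ⋆ₗ Ψ p.1) p.2) =
      fun x : ℝ × ℝ³ => ∫⁻ y, Φ x.1 y * Ψ x.1 (x.2 - y) := by
    funext p; simp only [lconv_apply]
  rw [heq]
  exact h.lintegral_prod_right'

/-- Joint measurability of the majorant `maj F G`. [folklore] -/
theorem measurable_maj_uncurry (hF : Measurable (uncurry F)) (hG : Measurable (uncurry G)) :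
    Measurable (uncurry (maj F G)) :=
  measurable_lconv_uncurry (Φ := fun s η => ‖F s η‖ₑ) (Ψ := fun s η => ‖G s η‖ₑ)
    hF.enorm hG.enorm

/-- Joint measurability of the nonlinearity `nl F G`. [folklore] -/
theorem measurable_nl_uncurry (hF : Measurable (uncurry F)) (hG : Measurable (uncurry G)) :
    Measurable (uncurry (nl F G)) := by
  have h1 : Measurable fun p : ℝ × ℝ³ => ((‖p.2‖ : ℝ) : ℂ) :=
    (Complex.continuous_ofReal.comp (continuous_norm.comp continuous_snd)).measurable
  exact h1.mul (measurable_fconv_uncurry hF hG)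

/-- **Joint measurability of the bilinear Duhamel term** `(t, ξ) ↦ bilin ν T F G (t, ξ)`
(parametric Bochner integral of a jointly measurable integrand over the measurable moving
domain `0 < s ≤ clamp T t`). [folklore] -/
theorem measurable_bilin_uncurry (ν T : ℝ) (hF : Measurable (uncurry F))
    (hG : Measurable (uncurry G)) : Measurable (uncurry (bilin ν T F G)) := by
  -- the integrand on `(ℝ × ℝ³) × ℝ`, extended by zero off the moving domain
  set g : (ℝ × ℝ³) × ℝ → ℂ := fun q =>
    heat ν q.1.2 (clamp T q.1.1 - q.2) • nl F G q.2 q.1.2 with hg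
  set S : Set ((ℝ × ℝ³) × ℝ) := {q | q.2 ∈ Ioc 0 (clamp T q.1.1)} with hS
  have hSm : MeasurableSet S := by
    have h1 : Measurable fun q : (ℝ × ℝ³) × ℝ => q.2 := measurable_snd
    have h2 : Measurable fun q : (ℝ × ℝ³) × ℝ => clamp T q.1.1 :=
      (continuous_clamp T).measurable.comp measurable_fst.fst
    exact (measurableSet_lt measurable_const h1).inter (measurableSet_le h1 h2)
  have hgm : Measurable g := by
    have hh : Measurable fun q : (ℝ × ℝ³) × ℝ => heat ν q.1.2 (clamp T q.1.1 - q.2) := by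
      refine (continuous_heat_comp ν continuous_fst.snd ?_).measurable
      exact ((continuous_clamp T).comp continuous_fst.fst).sub continuous_snd
    exact hh.smul ((measurable_nl_uncurry hF hG).comp (measurable_snd.prodMk measurable_fst.snd))
  have hf : Measurable (S.indicator g) := hgm.indicator hSm
  have h2 := (hf.stronglyMeasurable.integral_prod_right' (ν := (volume : Measure ℝ))).measurable
  have heq : uncurry (bilin ν T F G) = fun x : ℝ × ℝ³ => ∫ s, S.indicator g (x, s) := by
    funext p
    simp only [uncurry, bilin]
    rw [intervalIntegral.integral_of_le (clamp_nonneg T p.1),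
      ← integral_indicator measurableSet_Ioc]
    rfl
  rw [heq]
  exact h2

/-- Measurability in time of the weighted norms `h1 F`. [folklore] -/
theorem measurable_h1 (hF : Measurable (uncurry F)) : Measurable (h1 F) := by
  have h : Measurable fun p : ℝ × ℝ³ => wt p.2 * ‖F p.1 p.2‖ₑ ^ 2 :=
    (measurable_wt.comp measurable_snd).mul (hF.enorm.pow_const 2)
  exact h.lintegral_prod_right'

/-- Measurability in time of the weighted norms `h2 F`. [folklore] -/
theorem measurable_h2 (hF : Measurable (uncurry F)) : Measurable (h2 F) := by
  have h : Measurable fun p : ℝ × ℝ³ => wt p.2 ^ 2 * ‖F p.1 p.2‖ₑ ^ 2 :=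
    ((measurable_wt.comp measurable_snd).pow_const 2).mul (hF.enorm.pow_const 2)
  exact h.lintegral_prod_right'

/-- The free evolution of a measurable datum is jointly measurable. [folklore] -/
theorem measurable_free_uncurry (ν T : ℝ) {a : ℝ³ → ℂ} (ha : Measurable a) :
    Measurable (uncurry (free ν T a)) := by
  have hh : Measurable fun p : ℝ × ℝ³ => ((heat ν p.2 (clamp T p.1) : ℝ) : ℂ) :=
    (Complex.continuous_ofReal.comp (continuous_heat_comp ν continuous_snd
      ((continuous_clamp T).comp continuous_fst))).measurable
  exact hh.mul (ha.comp measurable_snd)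

/-- Sums of jointly measurable trajectories are jointly measurable. [folklore] -/
theorem measurable_uncurry_add (hF : Measurable (uncurry F)) (hG : Measurable (uncurry G)) :
    Measurable (uncurry (F + G)) := hF.add hG

/-- Differences of jointly measurable trajectories are jointly measurable. [folklore] -/
theorem measurable_uncurry_sub (hF : Measurable (uncurry F)) (hG : Measurable (uncurry G)) :
    Measurable (uncurry (F - G)) := hF.sub hG

end Measurability

/-! ### Fixed-frequency time estimates for the bilinear term (parabolic gain) -/

section FixedFrequency

variable {ν T : ℝ} {F G : ℝ → ℝ³ → ℂ}

/-- **Sup-in-time bound at a fixed frequency**: for `t ∈ [0,T]`,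
`‖bilin(t,ξ)‖² ≤ (2ν)⁻¹ ∫₀ᵀ maj(s,ξ)² ds` (tree `enorm_duhamel_sq_le`). [folklore] -/
theorem enorm_bilin_sq_le (hν : 0 < ν) (hF : Measurable (uncurry F)) (hG : Measurable (uncurry G))
    {t : ℝ} (ht : t ∈ Icc (0 : ℝ) T) (ξ : ℝ³) :
    ‖bilin ν T F G t ξ‖ₑ ^ 2 ≤
      ENNReal.ofReal (1 / (2 * ν)) * ∫⁻ s in Ioc 0 T, maj F G s ξ ^ 2 := by
  rw [bilin_of_mem F G ht]
  have hφ : AEMeasurable (fun s => maj F G s ξ) (volume.restrict (Ioc 0 T)) :=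
    ((measurable_maj_uncurry hF hG).comp (measurable_id.prodMk measurable_const)).aemeasurable
  exact enorm_duhamel_sq_le hν hφ (fun s _ => enorm_nl_le F G s ξ) ht

/-- **`L²`-in-time bound at a fixed frequency** (Schur):
`ν |ξ|⁴ ∫₀ᵀ ‖bilin(t,ξ)‖² dt ≤ ν⁻¹ |ξ|² ∫₀ᵀ maj(s,ξ)² ds`
(tree `lintegral_enorm_duhamel_sq_le`). [folklore] -/
theorem lintegral_enorm_bilin_sq_le (hν : 0 < ν) (hF : Measurable (uncurry F))
    (hG : Measurable (uncurry G)) (ξ : ℝ³) :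
    ENNReal.ofReal (ν * ‖ξ‖ ^ 4) * ∫⁻ t in Ioc 0 T, ‖bilin ν T F G t ξ‖ₑ ^ 2 ≤
      ENNReal.ofReal (ν⁻¹ * ‖ξ‖ ^ 2) * ∫⁻ s in Ioc 0 T, maj F G s ξ ^ 2 := by
  have hφ : AEMeasurable (fun s => maj F G s ξ) (volume.restrict (Ioc 0 T)) :=
    ((measurable_maj_uncurry hF hG).comp (measurable_id.prodMk measurable_const)).aemeasurable
  have hNm : AEStronglyMeasurable (fun s => nl F G s ξ) (volume.restrict (Ioc 0 T)) :=
    ((measurable_nl_uncurry hF hG).comp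
      (measurable_id.prodMk measurable_const)).aestronglyMeasurable
  have h := lintegral_enorm_duhamel_sq_le (T := T) hν hNm hφ (fun s _ => enorm_nl_le F G s ξ)
  refine le_trans (le_of_eq ?_) h
  congr 1
  refine setLIntegral_congr_fun measurableSet_Ioc fun t ht => ?_
  rw [bilin_of_mem F G ⟨ht.1.le, ht.2⟩]

/-- **The weighted `L²_t` bound at a fixed frequency**: for `0 < T ≤ 1`,
`(1+|ξ|²)² ∫₀ᵀ ‖bilin(t,ξ)‖² dt ≤ C_ν (1+|ξ|²) ∫₀ᵀ maj(s,ξ)² ds`, `C_ν = max(1/ν, 2/ν²)`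
(low frequencies by the sup bound, high frequencies by the Schur bound). [folklore] -/
theorem wt_sq_mul_lintegral_enorm_bilin_sq_le (hν : 0 < ν) (hT1 : T ≤ 1)
    (hF : Measurable (uncurry F)) (hG : Measurable (uncurry G)) (ξ : ℝ³) :
    wt ξ ^ 2 * ∫⁻ t in Ioc 0 T, ‖bilin ν T F G t ξ‖ₑ ^ 2 ≤
      ENNReal.ofReal (max (1 / ν) (2 / ν ^ 2)) * wt ξ * ∫⁻ s in Ioc 0 T, maj F G s ξ ^ 2 := by
  set X : ℝ≥0∞ := ∫⁻ t in Ioc 0 T, ‖bilin ν T F G t ξ‖ₑ ^ 2 with hX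
  set I : ℝ≥0∞ := ∫⁻ s in Ioc 0 T, maj F G s ξ ^ 2 with hI
  set C : ℝ := max (1 / ν) (2 / ν ^ 2) with hC
  -- low frequencies: the sup bound integrated over the window of length `T ≤ 1`
  have hX1 : X ≤ ENNReal.ofReal (1 / (2 * ν)) * I := by
    calc X ≤ ∫⁻ _ in Ioc 0 T, ENNReal.ofReal (1 / (2 * ν)) * I :=
          setLIntegral_mono' measurableSet_Ioc fun t ht =>
            enorm_bilin_sq_le hν hF hG ⟨ht.1.le, ht.2⟩ ξ
      _ = ENNReal.ofReal (1 / (2 * ν)) * I * ENNReal.ofReal T := by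
          rw [setLIntegral_const, Real.volume_Ioc, sub_zero]
      _ ≤ ENNReal.ofReal (1 / (2 * ν)) * I * 1 := by
          gcongr; rw [← ENNReal.ofReal_one]; exact ENNReal.ofReal_le_ofReal hT1
      _ = _ := mul_one _
  -- high frequencies: the Schur bound divided by `ν`
  have hX2 : ENNReal.ofReal (‖ξ‖ ^ 4) * X ≤ ENNReal.ofReal (ν⁻¹ * ν⁻¹ * ‖ξ‖ ^ 2) * I := by
    have h := lintegral_enorm_bilin_sq_le (T := T) hν hF hG ξ
    have h' := mul_le_mul' (le_refl (ENNReal.ofReal ν⁻¹)) h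
    rw [← mul_assoc, ← mul_assoc, ← ENNReal.ofReal_mul (by positivity),
      ← ENNReal.ofReal_mul (by positivity)] at h'
    have e1 : ν⁻¹ * (ν * ‖ξ‖ ^ 4) = ‖ξ‖ ^ 4 := by field_simp
    have e2 : ν⁻¹ * (ν⁻¹ * ‖ξ‖ ^ 2) = ν⁻¹ * ν⁻¹ * ‖ξ‖ ^ 2 := by ring
    rwa [e1, e2] at h'
  have hν1 : 2 * (1 / (2 * ν)) = 1 / ν := by field_simp
  calc wt ξ ^ 2 * X ≤ (2 + 2 * ENNReal.ofReal (‖ξ‖ ^ 4)) * X := mul_le_mul' (wt_sq_le ξ) le_rfl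
    _ = 2 * X + 2 * (ENNReal.ofReal (‖ξ‖ ^ 4) * X) := by ring
    _ ≤ 2 * (ENNReal.ofReal (1 / (2 * ν)) * I) +
          2 * (ENNReal.ofReal (ν⁻¹ * ν⁻¹ * ‖ξ‖ ^ 2) * I) := add_le_add (mul_le_mul' le_rfl hX1)
            (mul_le_mul' le_rfl hX2)
    _ = ENNReal.ofReal (2 * (1 / (2 * ν))) * I +
          ENNReal.ofReal (2 * (ν⁻¹ * ν⁻¹ * ‖ξ‖ ^ 2)) * I := by
        rw [ENNReal.ofReal_mul (p := 2) (by norm_num), ENNReal.ofReal_mul (p := 2) (by norm_num),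
          ENNReal.ofReal_ofNat]
        ring
    _ = ENNReal.ofReal (1 / ν + 2 * (ν⁻¹ * ν⁻¹) * ‖ξ‖ ^ 2) * I := by
        have hr : 2 * (1 / (2 * ν)) + 2 * (ν⁻¹ * ν⁻¹ * ‖ξ‖ ^ 2) =
            1 / ν + 2 * (ν⁻¹ * ν⁻¹) * ‖ξ‖ ^ 2 := by rw [hν1]; ring
        rw [← add_mul, ← ENNReal.ofReal_add (by positivity) (by positivity), hr]
    _ ≤ ENNReal.ofReal (C * (1 + ‖ξ‖ ^ 2)) * I := by
        gcongr
        have h1 : 1 / ν ≤ C := le_max_left _ _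
        have h2 : 2 * (ν⁻¹ * ν⁻¹) ≤ C := by
          rw [hC, show 2 * (ν⁻¹ * ν⁻¹) = 2 / ν ^ 2 by field_simp]; exact le_max_right _ _
        nlinarith [sq_nonneg ‖ξ‖]
    _ = ENNReal.ofReal C * wt ξ * I := by
        rw [ENNReal.ofReal_mul (by positivity), wt_apply]

end FixedFrequency

/-! ### Elementary `ℝ≥0∞` algebra -/

/-- `‖x + y‖ₑ² ≤ 2 ‖x‖ₑ² + 2 ‖y‖ₑ²`. [folklore] -/
theorem enorm_add_sq_le (x y : ℂ) : ‖x + y‖ₑ ^ 2 ≤ 2 * ‖x‖ₑ ^ 2 + 2 * ‖y‖ₑ ^ 2 := by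
  calc ‖x + y‖ₑ ^ 2 ≤ (‖x‖ₑ + ‖y‖ₑ) ^ 2 := pow_le_pow_left' (enorm_add_le x y) 2
    _ ≤ 2 * (‖x‖ₑ ^ 2 + ‖y‖ₑ ^ 2) := ennreal_add_sq_le_two_mul _ _
    _ = _ := mul_add _ _ _

/-- `‖x - y‖ₑ² ≤ 2 ‖x‖ₑ² + 2 ‖y‖ₑ²`. [folklore] -/
theorem enorm_sub_sq_le (x y : ℂ) : ‖x - y‖ₑ ^ 2 ≤ 2 * ‖x‖ₑ ^ 2 + 2 * ‖y‖ₑ ^ 2 := by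
  calc ‖x - y‖ₑ ^ 2 ≤ (‖x‖ₑ + ‖y‖ₑ) ^ 2 := pow_le_pow_left' (enorm_sub_le) 2
    _ ≤ 2 * (‖x‖ₑ ^ 2 + ‖y‖ₑ ^ 2) := ennreal_add_sq_le_two_mul _ _
    _ = _ := mul_add _ _ _

/-! ### The product estimate at a fixed time -/

section Product

/-- **Weighted Young inequality for the majorant convolution** (Peetre + Young `L² ∗ L¹ → L²`):
`∫ (1+|ξ|²) (|f| ⋆ₗ |g|)(ξ)² dξ ≤ 16 (‖f‖₁² ∫ (1+|ξ|²)|g|² + ‖g‖₁² ∫ (1+|ξ|²)|f|²)` — the Fourier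
form of `‖fg‖_{H¹} ≲ ‖f̂‖_{L¹} ‖g‖_{H¹} + ‖ĝ‖_{L¹} ‖f‖_{H¹}`. [folklore] -/
theorem lintegral_wt_mul_lconv_sq_le {f g : ℝ³ → ℂ} (hf : Measurable f) (hg : Measurable g) :
    ∫⁻ ξ, wt ξ * ((fun η => ‖f η‖ₑ) ⋆ₗ (fun η => ‖g η‖ₑ)) ξ ^ 2 ≤
      16 * ((∫⁻ η, ‖f η‖ₑ) ^ 2 * (∫⁻ η, wt η * ‖g η‖ₑ ^ 2) +
        (∫⁻ η, ‖g η‖ₑ) ^ 2 * ∫⁻ η, wt η * ‖f η‖ₑ ^ 2) := by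
  set Φ : ℝ³ → ℝ≥0∞ := fun η => ‖f η‖ₑ with hΦ
  set Ψ : ℝ³ → ℝ≥0∞ := fun η => ‖g η‖ₑ with hΨ
  set w1 : ℝ³ → ℝ≥0∞ := fun η => ENNReal.ofReal ((1 + ‖η‖) ^ 1) with hw1
  have hΦm : Measurable Φ := hf.enorm
  have hΨm : Measurable Ψ := hg.enorm
  have hw1m : Measurable w1 := measurable_ofReal_weight 1
  have hwΦ : Measurable fun η => w1 η * Φ η := hw1m.mul hΦm
  have hwΨ : Measurable fun η => w1 η * Ψ η := hw1m.mul hΨm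
  -- pointwise Peetre
  have hpt : ∀ ξ, wt ξ * (Φ ⋆ₗ Ψ) ξ ^ 2 ≤
      8 * ((Φ ⋆ₗ fun η => w1 η * Ψ η) ξ ^ 2 + ((fun η => w1 η * Φ η) ⋆ₗ Ψ) ξ ^ 2) := by
    intro ξ
    have hP := weight_mul_lconv_le hΦm.aemeasurable hΨm.aemeasurable 1 ξ
    calc wt ξ * (Φ ⋆ₗ Ψ) ξ ^ 2 ≤ w1 ξ ^ 2 * (Φ ⋆ₗ Ψ) ξ ^ 2 := mul_le_mul' (wt_le_sq ξ) le_rfl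
      _ = (w1 ξ * (Φ ⋆ₗ Ψ) ξ) ^ 2 := by ring
      _ ≤ (2 ^ 1 * ((Φ ⋆ₗ fun η => w1 η * Ψ η) ξ + ((fun η => w1 η * Φ η) ⋆ₗ Ψ) ξ)) ^ 2 :=
          pow_le_pow_left' hP 2
      _ = 4 * ((Φ ⋆ₗ fun η => w1 η * Ψ η) ξ + ((fun η => w1 η * Φ η) ⋆ₗ Ψ) ξ) ^ 2 := by ring
      _ ≤ 4 * (2 * ((Φ ⋆ₗ fun η => w1 η * Ψ η) ξ ^ 2 + ((fun η => w1 η * Φ η) ⋆ₗ Ψ) ξ ^ 2)) :=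
          mul_le_mul' le_rfl (ennreal_add_sq_le_two_mul _ _)
      _ = _ := by ring
  -- the two Young bounds
  have hw1sq : ∀ (Θ : ℝ³ → ℝ≥0∞), ∫⁻ η, (w1 η * Θ η) ^ 2 ≤ 2 * ∫⁻ η, wt η * Θ η ^ 2 := by
    intro Θ
    rw [← lintegral_const_mul' _ _ (by norm_num)]
    refine lintegral_mono fun η => ?_
    calc (w1 η * Θ η) ^ 2 = w1 η ^ 2 * Θ η ^ 2 := mul_pow _ _ _
      _ ≤ 2 * wt η * Θ η ^ 2 := mul_le_mul' (sq_le_two_mul_wt η) le_rfl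
      _ = _ := mul_assoc _ _ _
  have hA : ∫⁻ ξ, (Φ ⋆ₗ fun η => w1 η * Ψ η) ξ ^ 2 ≤
      (∫⁻ η, Φ η) ^ 2 * (2 * ∫⁻ η, wt η * Ψ η ^ 2) := by
    rw [lconvolution_comm]
    exact (lintegral_lconv_sq_le hwΨ.aemeasurable hΦm.aemeasurable).trans
      (mul_le_mul' le_rfl (hw1sq Ψ))
  have hB : ∫⁻ ξ, ((fun η => w1 η * Φ η) ⋆ₗ Ψ) ξ ^ 2 ≤
      (∫⁻ η, Ψ η) ^ 2 * (2 * ∫⁻ η, wt η * Φ η ^ 2) :=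
    (lintegral_lconv_sq_le hwΦ.aemeasurable hΨm.aemeasurable).trans
      (mul_le_mul' le_rfl (hw1sq Φ))
  have hmA : Measurable fun ξ => (Φ ⋆ₗ fun η => w1 η * Ψ η) ξ ^ 2 :=
    (measurable_lconvolution volume hΦm hwΨ).pow_const 2
  calc ∫⁻ ξ, wt ξ * (Φ ⋆ₗ Ψ) ξ ^ 2
      ≤ ∫⁻ ξ, 8 * ((Φ ⋆ₗ fun η => w1 η * Ψ η) ξ ^ 2 + ((fun η => w1 η * Φ η) ⋆ₗ Ψ) ξ ^ 2) :=
        lintegral_mono hpt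
    _ = 8 * ((∫⁻ ξ, (Φ ⋆ₗ fun η => w1 η * Ψ η) ξ ^ 2) +
          ∫⁻ ξ, ((fun η => w1 η * Φ η) ⋆ₗ Ψ) ξ ^ 2) := by
        rw [lintegral_const_mul' _ _ (by norm_num), lintegral_add_left hmA]
    _ ≤ 8 * ((∫⁻ η, Φ η) ^ 2 * (2 * ∫⁻ η, wt η * Ψ η ^ 2) +
          (∫⁻ η, Ψ η) ^ 2 * (2 * ∫⁻ η, wt η * Φ η ^ 2)) := by gcongr
    _ = _ := by ring

end Product

/-! ### The `L¹` mass from the weighted `L²` norms: low/high frequency splitting -/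

section Split

/-- The tail constant `ε_L = ∫_{|ξ| ≥ L} (1+|ξ|²)⁻² dξ`. [folklore] -/
def epsTail (L : ℝ) : ℝ≥0∞ := ∫⁻ ξ in (ball (0 : ℝ³) L)ᶜ, (wt ξ)⁻¹ ^ 2

/-- Unfolding `epsTail`. [folklore] -/
theorem epsTail_apply (L : ℝ) : epsTail L = ∫⁻ ξ in (ball (0 : ℝ³) L)ᶜ, (wt ξ)⁻¹ ^ 2 := rfl

/-- **`L¹` by splitting**: `‖Φ‖₁² ≤ 2 vol(B_L) ∫ w Φ² + 2 ε_L ∫ w² Φ²` (Cauchy–Schwarz on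
`B_L` and on its complement with the weight `w = 1 + |ξ|²`). [folklore] -/
theorem sq_lintegral_le_split {Φ : ℝ³ → ℝ≥0∞} (hΦ : Measurable Φ) (L : ℝ) :
    (∫⁻ ξ, Φ ξ) ^ 2 ≤ 2 * volume (ball (0 : ℝ³) L) * (∫⁻ ξ, wt ξ * Φ ξ ^ 2) +
      2 * epsTail L * ∫⁻ ξ, wt ξ ^ 2 * Φ ξ ^ 2 := by
  set B : Set ℝ³ := ball (0 : ℝ³) L with hB
  have hBm : MeasurableSet B := measurableSet_ball
  -- low frequencies
  have hlow : (∫⁻ ξ in B, Φ ξ) ^ 2 ≤ volume B * ∫⁻ ξ, wt ξ * Φ ξ ^ 2 := by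
    have h := sq_lintegral_mul_le (volume.restrict B) hΦ.aemeasurable aemeasurable_const
      (g := fun _ => (1 : ℝ≥0∞))
    simp only [mul_one, one_pow, lintegral_const, Measure.restrict_apply MeasurableSet.univ,
      univ_inter, one_mul] at h
    calc (∫⁻ ξ in B, Φ ξ) ^ 2 ≤ (∫⁻ ξ in B, Φ ξ ^ 2) * volume B := h
      _ ≤ (∫⁻ ξ, wt ξ * Φ ξ ^ 2) * volume B := by
          refine mul_le_mul' ((setLIntegral_le_lintegral B _).trans (lintegral_mono fun ξ => ?_))
            le_rfl
          calc Φ ξ ^ 2 = 1 * Φ ξ ^ 2 := (one_mul _).symm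
            _ ≤ wt ξ * Φ ξ ^ 2 := mul_le_mul' (one_le_wt ξ) le_rfl
      _ = _ := mul_comm _ _
  -- high frequencies
  have hhigh : (∫⁻ ξ in Bᶜ, Φ ξ) ^ 2 ≤ epsTail L * ∫⁻ ξ, wt ξ ^ 2 * Φ ξ ^ 2 := by
    have heq : ∀ ξ, Φ ξ = (wt ξ)⁻¹ * (wt ξ * Φ ξ) := fun ξ => by
      rw [← mul_assoc, ENNReal.inv_mul_cancel (wt_ne_zero ξ) (wt_ne_top ξ), one_mul]
    have h := sq_lintegral_mul_le (volume.restrict Bᶜ) (measurable_wt.inv).aemeasurable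
      (measurable_wt.mul hΦ).aemeasurable (f := fun ξ => (wt ξ)⁻¹) (g := fun ξ => wt ξ * Φ ξ)
    calc (∫⁻ ξ in Bᶜ, Φ ξ) ^ 2 = (∫⁻ ξ in Bᶜ, (wt ξ)⁻¹ * (wt ξ * Φ ξ)) ^ 2 := by
          rw [lintegral_congr fun ξ => heq ξ]
      _ ≤ (∫⁻ ξ in Bᶜ, (wt ξ)⁻¹ ^ 2) * ∫⁻ ξ in Bᶜ, (wt ξ * Φ ξ) ^ 2 := h
      _ ≤ epsTail L * ∫⁻ ξ, wt ξ ^ 2 * Φ ξ ^ 2 := by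
          refine mul_le_mul' le_rfl ((setLIntegral_le_lintegral Bᶜ _).trans
            (lintegral_mono fun ξ => ?_))
          rw [mul_pow]
  rw [← lintegral_add_compl Φ hBm]
  calc ((∫⁻ ξ in B, Φ ξ) + ∫⁻ ξ in Bᶜ, Φ ξ) ^ 2
      ≤ 2 * ((∫⁻ ξ in B, Φ ξ) ^ 2 + (∫⁻ ξ in Bᶜ, Φ ξ) ^ 2) := ennreal_add_sq_le_two_mul _ _
    _ ≤ 2 * (volume B * (∫⁻ ξ, wt ξ * Φ ξ ^ 2) + epsTail L * ∫⁻ ξ, wt ξ ^ 2 * Φ ξ ^ 2) := by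
        gcongr
    _ = _ := by ring

end Split

/-! ### The time-integrated product estimate -/

section Theta

variable {T : ℝ} {F G : ℝ → ℝ³ → ℂ}

/-- **The `L²_t H¹` size of the nonlinearity's majorant**: for jointly measurable `F, G`,
`∫₀ᵀ ∫ (1+|ξ|²) maj(s,ξ)² dξ ds ≤ 64 (vol(B_L) T + ε_L) qnorm(F) qnorm(G)` — the Fourier form of
`‖|D|(uv)‖_{L²_t L²} + ‖uv‖_{L²_tL²} ≲ (vol(B_L)T + ε_L)^{1/2} ‖u‖_{X_T} ‖v‖_{X_T}`. [folklore] -/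
theorem lintegral_lintegral_wt_maj_sq_le (hF : Measurable (uncurry F))
    (hG : Measurable (uncurry G)) (L : ℝ) :
    ∫⁻ s in Ioc 0 T, ∫⁻ ξ, wt ξ * maj F G s ξ ^ 2 ≤
      64 * (volume (ball (0 : ℝ³) L) * ENNReal.ofReal T + epsTail L) *
        qnorm T F * qnorm T G := by
  set vL : ℝ≥0∞ := volume (ball (0 : ℝ³) L) with hvL
  set εL : ℝ≥0∞ := epsTail L with hεL
  set QF : ℝ≥0∞ := qnorm T F with hQF
  set QG : ℝ≥0∞ := qnorm T G with hQG
  -- pointwise in time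
  have hfix : ∀ s ∈ Ioc (0 : ℝ) T, ∫⁻ ξ, wt ξ * maj F G s ξ ^ 2 ≤
      64 * vL * QF * QG + 32 * εL * QG * h2 F s + 32 * εL * QF * h2 G s := by
    intro s hs
    have hs' : s ∈ Icc (0 : ℝ) T := ⟨hs.1.le, hs.2⟩
    have hP := lintegral_wt_mul_lconv_sq_le (measurable_slice hF s) (measurable_slice hG s)
    have hSF := sq_lintegral_le_split (Φ := fun η => ‖F s η‖ₑ) (measurable_slice hF s).enorm L
    have hSG := sq_lintegral_le_split (Φ := fun η => ‖G s η‖ₑ) (measurable_slice hG s).enorm L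
    have h1F : ∫⁻ η, wt η * ‖F s η‖ₑ ^ 2 ≤ QF := h1_le_qnorm F hs'
    have h1G : ∫⁻ η, wt η * ‖G s η‖ₑ ^ 2 ≤ QG := h1_le_qnorm G hs'
    calc ∫⁻ ξ, wt ξ * maj F G s ξ ^ 2
        ≤ 16 * ((∫⁻ η, ‖F s η‖ₑ) ^ 2 * (∫⁻ η, wt η * ‖G s η‖ₑ ^ 2) +
            (∫⁻ η, ‖G s η‖ₑ) ^ 2 * ∫⁻ η, wt η * ‖F s η‖ₑ ^ 2) := hP
      _ ≤ 16 * ((2 * vL * (∫⁻ η, wt η * ‖F s η‖ₑ ^ 2) + 2 * εL * h2 F s) * QG +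
            (2 * vL * (∫⁻ η, wt η * ‖G s η‖ₑ ^ 2) + 2 * εL * h2 G s) * QF) := by
          gcongr
          · exact hSF
          · exact hSG
      _ ≤ 16 * ((2 * vL * QF + 2 * εL * h2 F s) * QG + (2 * vL * QG + 2 * εL * h2 G s) * QF) := by
          gcongr
      _ = _ := by ring
  -- integrate in time
  have hmF : Measurable fun s => 32 * εL * QG * h2 F s := (measurable_h2 hF).const_mul _
  have hmG : Measurable fun s => 32 * εL * QF * h2 G s := (measurable_h2 hG).const_mul _
  calc ∫⁻ s in Ioc 0 T, ∫⁻ ξ, wt ξ * maj F G s ξ ^ 2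
      ≤ ∫⁻ s in Ioc 0 T, (64 * vL * QF * QG + 32 * εL * QG * h2 F s + 32 * εL * QF * h2 G s) :=
        setLIntegral_mono' measurableSet_Ioc hfix
    _ = 64 * vL * QF * QG * ENNReal.ofReal T + 32 * εL * QG * qint T F +
          32 * εL * QF * qint T G := by
        rw [lintegral_add_right _ hmG, lintegral_add_right _ hmF, setLIntegral_const,
          Real.volume_Ioc, sub_zero, lintegral_const_mul _ (measurable_h2 hF),
          lintegral_const_mul _ (measurable_h2 hG), qint_apply, qint_apply]
    _ ≤ 64 * vL * QF * QG * ENNReal.ofReal T + 32 * εL * QG * QF + 32 * εL * QF * QG := by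
        gcongr
        · exact qint_le_qnorm T F
        · exact qint_le_qnorm T G
    _ = _ := by ring

end Theta

/-! ### The bilinear estimate -/

section Main

variable {ν T : ℝ} {F G : ℝ → ℝ³ → ℂ}

/-- The constant of the bilinear estimate, `C_ν = 64 max(1/ν, 2/ν²)`. [folklore] -/
def cBil (ν : ℝ) : ℝ := 64 * max (1 / ν) (2 / ν ^ 2)

/-- `C_ν ≥ 0`. [folklore] -/
theorem cBil_nonneg {ν : ℝ} (hν : 0 < ν) : 0 ≤ cBil ν := by
  rw [cBil]; positivity

/-- **The bilinear estimate in `X_T = L^∞_t H¹ ∩ L²_t H²` on the Fourier side.** For `ν > 0`,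
`0 < T ≤ 1`, jointly measurable `F, G` and every `L`,
`qnorm T (bilin ν T F G) ≤ C_ν (vol(B_L) T + ε_L) qnorm T F · qnorm T G`
(squared norms; `C_ν = 64 max(1/ν, 2/ν²)`): Tonelli, the fixed-frequency parabolic bounds
`enorm_bilin_sq_le` / `wt_sq_mul_lintegral_enorm_bilin_sq_le`, and the time-integrated product
estimate `lintegral_lintegral_wt_maj_sq_le` (Lemarié-Rieusset 2016, Prop. 11.1: the estimate
`‖B(u,u)‖_{L^∞H¹} + √ν ‖B(u,u)‖_{L²Ḣ²} ≤ …`, here with the short-time smallness produced by the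
frequency splitting at `|ξ| = L`). [folklore] -/
theorem qnorm_bilin_le (hν : 0 < ν) (hT1 : T ≤ 1) (hF : Measurable (uncurry F))
    (hG : Measurable (uncurry G)) (L : ℝ) :
    qnorm T (bilin ν T F G) ≤ ENNReal.ofReal (cBil ν) *
      (volume (ball (0 : ℝ³) L) * ENNReal.ofReal T + epsTail L) * qnorm T F * qnorm T G := by
  set Cd : ℝ := max (1 / ν) (2 / ν ^ 2) with hCd
  have hCd0 : 0 ≤ Cd := by positivity
  set Θ' : ℝ≥0∞ := ∫⁻ ξ, wt ξ * ∫⁻ s in Ioc 0 T, maj F G s ξ ^ 2 with hΘ'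
  have hmaj : Measurable (uncurry (maj F G)) := measurable_maj_uncurry hF hG
  -- Tonelli for `Θ'`
  have hswap : Θ' = ∫⁻ s in Ioc 0 T, ∫⁻ ξ, wt ξ * maj F G s ξ ^ 2 := by
    calc Θ' = ∫⁻ ξ, ∫⁻ s in Ioc 0 T, wt ξ * maj F G s ξ ^ 2 :=
          lintegral_congr fun ξ => (lintegral_const_mul' _ _ (wt_ne_top ξ)).symm
      _ = ∫⁻ s in Ioc 0 T, ∫⁻ ξ, wt ξ * maj F G s ξ ^ 2 := by
          refine lintegral_lintegral_swap ?_
          have h1 : Measurable fun z : ℝ³ × ℝ => wt z.1 * maj F G z.2 z.1 ^ 2 :=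
            (measurable_wt.comp measurable_fst).mul ((hmaj.comp measurable_swap).pow_const 2)
          exact h1.aemeasurable
  -- the sup part
  have hsup : qsup T (bilin ν T F G) ≤ ENNReal.ofReal Cd * Θ' := by
    refine qsup_le_iff.2 fun t ht => ?_
    calc h1 (bilin ν T F G) t = ∫⁻ ξ, wt ξ * ‖bilin ν T F G t ξ‖ₑ ^ 2 := rfl
      _ ≤ ∫⁻ ξ, wt ξ * (ENNReal.ofReal (1 / (2 * ν)) * ∫⁻ s in Ioc 0 T, maj F G s ξ ^ 2) :=
          lintegral_mono fun ξ => mul_le_mul' le_rfl (enorm_bilin_sq_le hν hF hG ht ξ)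
      _ = ENNReal.ofReal (1 / (2 * ν)) * Θ' := by
          rw [hΘ', ← lintegral_const_mul' _ _ ENNReal.ofReal_ne_top]
          exact lintegral_congr fun ξ => by ring
      _ ≤ ENNReal.ofReal Cd * Θ' := by
          gcongr
          calc 1 / (2 * ν) ≤ 1 / ν := by
                rw [div_le_div_iff₀ (by positivity) hν]; nlinarith
            _ ≤ Cd := le_max_left _ _
  -- the integral part
  have hint : qint T (bilin ν T F G) ≤ ENNReal.ofReal Cd * Θ' := by
    have hmb : Measurable (uncurry (bilin ν T F G)) := measurable_bilin_uncurry ν T hF hG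
    calc qint T (bilin ν T F G)
        = ∫⁻ t in Ioc 0 T, ∫⁻ ξ, wt ξ ^ 2 * ‖bilin ν T F G t ξ‖ₑ ^ 2 := rfl
      _ = ∫⁻ ξ, ∫⁻ t in Ioc 0 T, wt ξ ^ 2 * ‖bilin ν T F G t ξ‖ₑ ^ 2 := by
          refine lintegral_lintegral_swap ?_
          have h1 : Measurable fun z : ℝ × ℝ³ => wt z.2 ^ 2 * ‖bilin ν T F G z.1 z.2‖ₑ ^ 2 :=
            ((measurable_wt.comp measurable_snd).pow_const 2).mul (hmb.enorm.pow_const 2)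
          exact h1.aemeasurable
      _ = ∫⁻ ξ, wt ξ ^ 2 * ∫⁻ t in Ioc 0 T, ‖bilin ν T F G t ξ‖ₑ ^ 2 :=
          lintegral_congr fun ξ => lintegral_const_mul' _ _ (ENNReal.pow_ne_top (wt_ne_top ξ))
      _ ≤ ∫⁻ ξ, ENNReal.ofReal Cd * wt ξ * ∫⁻ s in Ioc 0 T, maj F G s ξ ^ 2 :=
          lintegral_mono fun ξ => wt_sq_mul_lintegral_enorm_bilin_sq_le hν hT1 hF hG ξ
      _ = ENNReal.ofReal Cd * Θ' := by
          rw [hΘ', ← lintegral_const_mul' _ _ ENNReal.ofReal_ne_top]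
          exact lintegral_congr fun ξ => by ring
  have hΘ := lintegral_lintegral_wt_maj_sq_le (T := T) hF hG L
  rw [← hswap] at hΘ
  calc qnorm T (bilin ν T F G) ≤ ENNReal.ofReal Cd * Θ' := max_le hsup hint
    _ ≤ ENNReal.ofReal Cd * (64 * (volume (ball (0 : ℝ³) L) * ENNReal.ofReal T + epsTail L) *
          qnorm T F * qnorm T G) := mul_le_mul' le_rfl hΘ
    _ = _ := by
        rw [cBil, ← hCd, ENNReal.ofReal_mul (by norm_num), ENNReal.ofReal_ofNat]
        ring_nf

end Main

/-! ### The free evolution -/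

section Free

variable {ν T : ℝ}

/-- The constant of the free evolution bound, `max(2, 1/ν)`. [folklore] -/
def cFree (ν : ℝ) : ℝ := max 2 (1 / ν)

/-- `1 ≤ cFree ν`. [folklore] -/
theorem one_le_cFree (ν : ℝ) : 1 ≤ cFree ν := le_trans (by norm_num) (le_max_left _ _)

/-- The time integral of the squared heat factor over the window: for `t ∈ (0, T]`,
`∫₀ᵀ e^{-2νt|ξ|²} dt ≤ min(T, 1/(2ν|ξ|²))`, in the form
`(1+|ξ|²)² ∫₀ᵀ heat² ≤ max(2, 1/ν) (1+|ξ|²)` for `T ≤ 1`. [folklore] -/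
theorem wt_sq_mul_lintegral_heat_sq_le (hν : 0 < ν) (hT : 0 ≤ T) (hT1 : T ≤ 1) (ξ : ℝ³) :
    wt ξ ^ 2 * ∫⁻ t in Ioc 0 T, ENNReal.ofReal (heat ν ξ t ^ 2) ≤
      ENNReal.ofReal (cFree ν) * wt ξ := by
  set J : ℝ≥0∞ := ∫⁻ t in Ioc 0 T, ENNReal.ofReal (heat ν ξ t ^ 2) with hJ
  -- `J ≤ T ≤ 1`
  have hJ1 : J ≤ 1 := by
    calc J ≤ ∫⁻ _ in Ioc 0 T, (1 : ℝ≥0∞) := setLIntegral_mono' measurableSet_Ioc fun t ht => by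
            rw [← ENNReal.ofReal_one]
            refine ENNReal.ofReal_le_ofReal ?_
            have h := heat_le_one hν.le ht.1.le ξ
            have h0 := heat_nonneg ν ξ t
            nlinarith
      _ = ENNReal.ofReal T := by rw [setLIntegral_const, Real.volume_Ioc, sub_zero, one_mul]
      _ ≤ 1 := by rw [← ENNReal.ofReal_one]; exact ENNReal.ofReal_le_ofReal hT1
  by_cases hr : ‖ξ‖ ≤ 1
  · -- low frequency: `w ≤ 2`
    have hw2 : wt ξ ≤ 2 := by
      calc wt ξ = ENNReal.ofReal (1 + ‖ξ‖ ^ 2) := rfl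
        _ ≤ ENNReal.ofReal 2 := ENNReal.ofReal_le_ofReal (by nlinarith [norm_nonneg ξ])
        _ = 2 := ENNReal.ofReal_ofNat 2
    calc wt ξ ^ 2 * J = wt ξ * (wt ξ * J) := by ring
      _ ≤ wt ξ * (2 * 1) := by gcongr
      _ ≤ ENNReal.ofReal (cFree ν) * wt ξ := by
          rw [mul_one, mul_comm]
          gcongr
          calc (2 : ℝ≥0∞) = ENNReal.ofReal 2 := (ENNReal.ofReal_ofNat 2).symm
            _ ≤ ENNReal.ofReal (cFree ν) := ENNReal.ofReal_le_ofReal (le_max_left _ _)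
  · -- high frequency: `J ≤ 1/(2ν|ξ|²)`
    have hr : 1 < ‖ξ‖ := not_le.mp hr
    have hr1 : 1 ≤ ‖ξ‖ ^ 2 := by nlinarith
    have hr2 : 0 < ‖ξ‖ ^ 2 := by positivity
    set γ : ℝ := 2 * ν * ‖ξ‖ ^ 2 with hγ
    have hγ0 : 0 < γ := by positivity
    have hJ2 : J ≤ ENNReal.ofReal (1 / γ) := by
      have h := lintegral_Ioc_exp_neg_mul_sub_le' (γ := γ) (s := 0) (T := T) hγ0 hT
      refine le_trans (le_of_eq (setLIntegral_congr_fun measurableSet_Ioc fun t _ => ?_)) h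
      rw [heat, sub_zero, sq, ← Real.exp_add]
      congr 1
      rw [hγ]; ring
    have hkey : wt ξ * ENNReal.ofReal (1 / γ) ≤ ENNReal.ofReal (cFree ν) := by
      rw [wt_apply, ← ENNReal.ofReal_mul (by positivity)]
      refine ENNReal.ofReal_le_ofReal (le_trans ?_ (le_max_right _ _))
      rw [hγ, div_eq_mul_inv, one_mul, ← div_eq_mul_inv, div_le_div_iff₀ (by positivity) hν]
      nlinarith [mul_le_mul_of_nonneg_left hr1 hν.le]
    calc wt ξ ^ 2 * J = wt ξ * (wt ξ * J) := by ring
      _ ≤ wt ξ * (wt ξ * ENNReal.ofReal (1 / γ)) := by gcongr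
      _ ≤ wt ξ * ENNReal.ofReal (cFree ν) := by gcongr
      _ = _ := mul_comm _ _

/-- **The free evolution in `X_T`**: for a measurable datum `a` and `0 < T ≤ 1`,
`qnorm T (free ν T a) ≤ max(2, 1/ν) ∫ (1+|ξ|²)|a|²` (the `L^∞_t H¹` part since `e^{-νt|ξ|²} ≤ 1`,
the `L²_t H²` part by `∫₀ᵀ e^{-2νt|ξ|²} dt ≤ min(T, 1/(2ν|ξ|²))`). [folklore] -/
theorem qnorm_free_le (hν : 0 < ν) (hT : 0 < T) (hT1 : T ≤ 1) {a : ℝ³ → ℂ} (ha : Measurable a) :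
    qnorm T (free ν T a) ≤ ENNReal.ofReal (cFree ν) * ∫⁻ ξ, wt ξ * ‖a ξ‖ₑ ^ 2 := by
  have hC1 : (1 : ℝ≥0∞) ≤ ENNReal.ofReal (cFree ν) := by
    rw [← ENNReal.ofReal_one]; exact ENNReal.ofReal_le_ofReal (one_le_cFree ν)
  have henorm : ∀ t ξ, ‖free ν T a t ξ‖ₑ = ENNReal.ofReal (heat ν ξ (clamp T t)) * ‖a ξ‖ₑ := by
    intro t ξ
    rw [free, enorm_mul, ← ofReal_norm, Complex.norm_real, Real.norm_of_nonneg (heat_nonneg _ _ _)]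
  -- sup part
  have hsup : qsup T (free ν T a) ≤ ENNReal.ofReal (cFree ν) * ∫⁻ ξ, wt ξ * ‖a ξ‖ₑ ^ 2 := by
    refine qsup_le_iff.2 fun t ht => ?_
    calc h1 (free ν T a) t = ∫⁻ ξ, wt ξ * ‖free ν T a t ξ‖ₑ ^ 2 := rfl
      _ ≤ ∫⁻ ξ, wt ξ * ‖a ξ‖ₑ ^ 2 := lintegral_mono fun ξ => by
          rw [henorm, mul_pow]
          refine mul_le_mul' le_rfl ?_
          calc ENNReal.ofReal (heat ν ξ (clamp T t)) ^ 2 * ‖a ξ‖ₑ ^ 2 ≤ 1 ^ 2 * ‖a ξ‖ₑ ^ 2 := by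
                gcongr
                rw [← ENNReal.ofReal_one]
                exact ENNReal.ofReal_le_ofReal (heat_le_one hν.le (clamp_nonneg T t) ξ)
            _ = ‖a ξ‖ₑ ^ 2 := by rw [one_pow, one_mul]
      _ = 1 * ∫⁻ ξ, wt ξ * ‖a ξ‖ₑ ^ 2 := (one_mul _).symm
      _ ≤ _ := mul_le_mul' hC1 le_rfl
  -- integral part
  have hint : qint T (free ν T a) ≤ ENNReal.ofReal (cFree ν) * ∫⁻ ξ, wt ξ * ‖a ξ‖ₑ ^ 2 := by
    have hmf : Measurable (uncurry (free ν T a)) := measurable_free_uncurry ν T ha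
    calc qint T (free ν T a) = ∫⁻ t in Ioc 0 T, ∫⁻ ξ, wt ξ ^ 2 * ‖free ν T a t ξ‖ₑ ^ 2 := rfl
      _ = ∫⁻ ξ, ∫⁻ t in Ioc 0 T, wt ξ ^ 2 * ‖free ν T a t ξ‖ₑ ^ 2 := by
          refine lintegral_lintegral_swap ?_
          have h1 : Measurable fun z : ℝ × ℝ³ => wt z.2 ^ 2 * ‖free ν T a z.1 z.2‖ₑ ^ 2 :=
            ((measurable_wt.comp measurable_snd).pow_const 2).mul (hmf.enorm.pow_const 2)
          exact h1.aemeasurable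
      _ = ∫⁻ ξ, wt ξ ^ 2 * (∫⁻ t in Ioc 0 T, ENNReal.ofReal (heat ν ξ t ^ 2)) * ‖a ξ‖ₑ ^ 2 := by
          refine lintegral_congr fun ξ => ?_
          rw [← lintegral_const_mul' _ _ (ENNReal.pow_ne_top (wt_ne_top ξ)),
            ← lintegral_mul_const' _ _ (ENNReal.pow_ne_top enorm_ne_top)]
          refine setLIntegral_congr_fun measurableSet_Ioc fun t ht => ?_
          rw [henorm, clamp_of_mem ⟨ht.1.le, ht.2⟩, mul_pow,
            ENNReal.ofReal_pow (heat_nonneg _ _ _)]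
          ring
      _ ≤ ∫⁻ ξ, ENNReal.ofReal (cFree ν) * wt ξ * ‖a ξ‖ₑ ^ 2 :=
          lintegral_mono fun ξ => mul_le_mul' (wt_sq_mul_lintegral_heat_sq_le hν hT.le hT1 ξ) le_rfl
      _ = ENNReal.ofReal (cFree ν) * ∫⁻ ξ, wt ξ * ‖a ξ‖ₑ ^ 2 := by
          rw [← lintegral_const_mul' _ _ ENNReal.ofReal_ne_top]
          exact lintegral_congr fun ξ => by ring
  exact max_le hsup hint

end Free

/-! ### Algebra of the squared norms -/

section Algebra

variable {T : ℝ} {F G : ℝ → ℝ³ → ℂ}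

/-- `h1 (F + G) t ≤ 2 h1 F t + 2 h1 G t`. [folklore] -/
theorem h1_add_le (hF : Measurable (uncurry F)) (t : ℝ) :
    h1 (F + G) t ≤ 2 * h1 F t + 2 * h1 G t := by
  have hm : Measurable fun ξ => 2 * (wt ξ * ‖F t ξ‖ₑ ^ 2) :=
    (measurable_wt.mul ((measurable_slice hF t).enorm.pow_const 2)).const_mul _
  calc h1 (F + G) t = ∫⁻ ξ, wt ξ * ‖F t ξ + G t ξ‖ₑ ^ 2 := rfl
    _ ≤ ∫⁻ ξ, (2 * (wt ξ * ‖F t ξ‖ₑ ^ 2) + 2 * (wt ξ * ‖G t ξ‖ₑ ^ 2)) :=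
        lintegral_mono fun ξ => by
          calc wt ξ * ‖F t ξ + G t ξ‖ₑ ^ 2 ≤ wt ξ * (2 * ‖F t ξ‖ₑ ^ 2 + 2 * ‖G t ξ‖ₑ ^ 2) :=
                mul_le_mul' le_rfl (enorm_add_sq_le _ _)
            _ = _ := by ring
    _ = 2 * h1 F t + 2 * h1 G t := by
        rw [lintegral_add_left hm, lintegral_const_mul' _ _ (by norm_num),
          lintegral_const_mul' _ _ (by norm_num), h1_apply, h1_apply]

/-- `h1 (F - G) t ≤ 2 h1 F t + 2 h1 G t`. [folklore] -/
theorem h1_sub_le (hF : Measurable (uncurry F)) (t : ℝ) :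
    h1 (F - G) t ≤ 2 * h1 F t + 2 * h1 G t := by
  have hm : Measurable fun ξ => 2 * (wt ξ * ‖F t ξ‖ₑ ^ 2) :=
    (measurable_wt.mul ((measurable_slice hF t).enorm.pow_const 2)).const_mul _
  calc h1 (F - G) t = ∫⁻ ξ, wt ξ * ‖F t ξ - G t ξ‖ₑ ^ 2 := rfl
    _ ≤ ∫⁻ ξ, (2 * (wt ξ * ‖F t ξ‖ₑ ^ 2) + 2 * (wt ξ * ‖G t ξ‖ₑ ^ 2)) :=
        lintegral_mono fun ξ => by
          calc wt ξ * ‖F t ξ - G t ξ‖ₑ ^ 2 ≤ wt ξ * (2 * ‖F t ξ‖ₑ ^ 2 + 2 * ‖G t ξ‖ₑ ^ 2) :=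
                mul_le_mul' le_rfl (enorm_sub_sq_le _ _)
            _ = _ := by ring
    _ = 2 * h1 F t + 2 * h1 G t := by
        rw [lintegral_add_left hm, lintegral_const_mul' _ _ (by norm_num),
          lintegral_const_mul' _ _ (by norm_num), h1_apply, h1_apply]

/-- `h2 (F + G) t ≤ 2 h2 F t + 2 h2 G t`. [folklore] -/
theorem h2_add_le (hF : Measurable (uncurry F)) (t : ℝ) :
    h2 (F + G) t ≤ 2 * h2 F t + 2 * h2 G t := by
  have hm : Measurable fun ξ => 2 * (wt ξ ^ 2 * ‖F t ξ‖ₑ ^ 2) :=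
    ((measurable_wt.pow_const 2).mul ((measurable_slice hF t).enorm.pow_const 2)).const_mul _
  calc h2 (F + G) t = ∫⁻ ξ, wt ξ ^ 2 * ‖F t ξ + G t ξ‖ₑ ^ 2 := rfl
    _ ≤ ∫⁻ ξ, (2 * (wt ξ ^ 2 * ‖F t ξ‖ₑ ^ 2) + 2 * (wt ξ ^ 2 * ‖G t ξ‖ₑ ^ 2)) :=
        lintegral_mono fun ξ => by
          calc wt ξ ^ 2 * ‖F t ξ + G t ξ‖ₑ ^ 2
              ≤ wt ξ ^ 2 * (2 * ‖F t ξ‖ₑ ^ 2 + 2 * ‖G t ξ‖ₑ ^ 2) :=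
                mul_le_mul' le_rfl (enorm_add_sq_le _ _)
            _ = _ := by ring
    _ = 2 * h2 F t + 2 * h2 G t := by
        rw [lintegral_add_left hm, lintegral_const_mul' _ _ (by norm_num),
          lintegral_const_mul' _ _ (by norm_num), h2_apply, h2_apply]

/-- `h2 (F - G) t ≤ 2 h2 F t + 2 h2 G t`. [folklore] -/
theorem h2_sub_le (hF : Measurable (uncurry F)) (t : ℝ) :
    h2 (F - G) t ≤ 2 * h2 F t + 2 * h2 G t := by
  have hm : Measurable fun ξ => 2 * (wt ξ ^ 2 * ‖F t ξ‖ₑ ^ 2) :=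
    ((measurable_wt.pow_const 2).mul ((measurable_slice hF t).enorm.pow_const 2)).const_mul _
  calc h2 (F - G) t = ∫⁻ ξ, wt ξ ^ 2 * ‖F t ξ - G t ξ‖ₑ ^ 2 := rfl
    _ ≤ ∫⁻ ξ, (2 * (wt ξ ^ 2 * ‖F t ξ‖ₑ ^ 2) + 2 * (wt ξ ^ 2 * ‖G t ξ‖ₑ ^ 2)) :=
        lintegral_mono fun ξ => by
          calc wt ξ ^ 2 * ‖F t ξ - G t ξ‖ₑ ^ 2
              ≤ wt ξ ^ 2 * (2 * ‖F t ξ‖ₑ ^ 2 + 2 * ‖G t ξ‖ₑ ^ 2) :=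
                mul_le_mul' le_rfl (enorm_sub_sq_le _ _)
            _ = _ := by ring
    _ = 2 * h2 F t + 2 * h2 G t := by
        rw [lintegral_add_left hm, lintegral_const_mul' _ _ (by norm_num),
          lintegral_const_mul' _ _ (by norm_num), h2_apply, h2_apply]

/-- **`qnorm (F + G) ≤ 2 qnorm F + 2 qnorm G`.** [folklore] -/
theorem qnorm_add_le (hF : Measurable (uncurry F)) (hG : Measurable (uncurry G)) :
    qnorm T (F + G) ≤ 2 * qnorm T F + 2 * qnorm T G := by
  refine max_le ?_ ?_
  · refine qsup_le_iff.2 fun t ht => (h1_add_le (G := G) hF t).trans ?_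
    gcongr
    · exact h1_le_qnorm F ht
    · exact h1_le_qnorm G ht
  · calc qint T (F + G) ≤ ∫⁻ t in Ioc 0 T, (2 * h2 F t + 2 * h2 G t) :=
          lintegral_mono fun t => h2_add_le (G := G) hF t
      _ = 2 * qint T F + 2 * qint T G := by
          rw [lintegral_add_left ((measurable_h2 hF).const_mul _),
            lintegral_const_mul _ (measurable_h2 hF), lintegral_const_mul _ (measurable_h2 hG),
            qint_apply, qint_apply]
      _ ≤ 2 * qnorm T F + 2 * qnorm T G := by
          gcongr
          · exact qint_le_qnorm T F
          · exact qint_le_qnorm T G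

/-- **`qnorm (F - G) ≤ 2 qnorm F + 2 qnorm G`.** [folklore] -/
theorem qnorm_sub_le (hF : Measurable (uncurry F)) (hG : Measurable (uncurry G)) :
    qnorm T (F - G) ≤ 2 * qnorm T F + 2 * qnorm T G := by
  refine max_le ?_ ?_
  · refine qsup_le_iff.2 fun t ht => (h1_sub_le (G := G) hF t).trans ?_
    gcongr
    · exact h1_le_qnorm F ht
    · exact h1_le_qnorm G ht
  · calc qint T (F - G) ≤ ∫⁻ t in Ioc 0 T, (2 * h2 F t + 2 * h2 G t) :=
          lintegral_mono fun t => h2_sub_le (G := G) hF t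
      _ = 2 * qint T F + 2 * qint T G := by
          rw [lintegral_add_left ((measurable_h2 hF).const_mul _),
            lintegral_const_mul _ (measurable_h2 hF), lintegral_const_mul _ (measurable_h2 hG),
            qint_apply, qint_apply]
      _ ≤ 2 * qnorm T F + 2 * qnorm T G := by
          gcongr
          · exact qint_le_qnorm T F
          · exact qint_le_qnorm T G

/-- `h1` only sees the a.e. class of the slice. [folklore] -/
theorem h1_congr_ae {t : ℝ} (h : F t =ᵐ[volume] G t) : h1 F t = h1 G t :=
  lintegral_congr_ae (by filter_upwards [h] with ξ hξ; rw [hξ])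

/-- `h2` only sees the a.e. class of the slice. [folklore] -/
theorem h2_congr_ae {t : ℝ} (h : F t =ᵐ[volume] G t) : h2 F t = h2 G t :=
  lintegral_congr_ae (by filter_upwards [h] with ξ hξ; rw [hξ])

/-- **`qnorm` only sees the a.e. classes of the slices on the window.** [folklore] -/
theorem qnorm_congr_ae (h : ∀ t ∈ Icc (0 : ℝ) T, F t =ᵐ[volume] G t) :
    qnorm T F = qnorm T G := by
  have hsup : ∀ {F G : ℝ → ℝ³ → ℂ}, (∀ t ∈ Icc (0 : ℝ) T, F t =ᵐ[volume] G t) →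
      qsup T F ≤ qsup T G := fun h =>
    qsup_le_iff.2 fun t ht => (h1_congr_ae (h t ht)).trans_le (h1_le_qsup _ ht)
  have h1 : qsup T F = qsup T G :=
    le_antisymm (hsup h) (hsup fun t ht => (h t ht).symm)
  have h2 : qint T F = qint T G :=
    setLIntegral_congr_fun measurableSet_Ioc fun t ht => h2_congr_ae (h t ⟨ht.1.le, ht.2⟩)
  rw [qnorm_apply, qnorm_apply, h1, h2]

end Algebra

/-! ### Bilinearity of `bilin` on trajectories of finite norm -/

section Linearity

variable {ν T : ℝ} {F F' G G' : ℝ → ℝ³ → ℂ}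

/-- `‖F(t)‖_{L²}² ≤ h1 F t`. [folklore] -/
theorem eLpNorm_sq_le_h1 (F : ℝ → ℝ³ → ℂ) (t : ℝ) : eLpNorm (F t) 2 volume ^ 2 ≤ h1 F t := by
  rw [← lintegral_enorm_sq_eq_eLpNorm_sq]
  exact lintegral_enorm_sq_le_h1 F t

/-- `‖F(t)‖_{L²} ≤ (qnorm T F)^{1/2}` for `t ∈ [0,T]`. [folklore] -/
theorem eLpNorm_slice_le (F : ℝ → ℝ³ → ℂ) {t : ℝ} (ht : t ∈ Icc (0 : ℝ) T) :
    eLpNorm (F t) 2 volume ≤ qnorm T F ^ (1 / 2 : ℝ) := by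
  have h : eLpNorm (F t) 2 volume ^ 2 ≤ qnorm T F := (eLpNorm_sq_le_h1 F t).trans (h1_le_qnorm F ht)
  calc eLpNorm (F t) 2 volume = (eLpNorm (F t) 2 volume ^ 2) ^ (1 / 2 : ℝ) := by
        rw [← ENNReal.rpow_natCast, ← ENNReal.rpow_mul]; norm_num
    _ ≤ qnorm T F ^ (1 / 2 : ℝ) := ENNReal.rpow_le_rpow h (by norm_num)

/-- Slices of a trajectory of finite `X_T`-norm are square integrable. [folklore] -/
theorem memLp_slice (hF : Measurable (uncurry F)) (hQ : qnorm T F ≠ ∞) {t : ℝ}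
    (ht : t ∈ Icc (0 : ℝ) T) : MemLp (F t) 2 volume :=
  ⟨(measurable_slice hF t).aestronglyMeasurable, lt_of_le_of_lt (eLpNorm_slice_le F ht)
    (ENNReal.rpow_lt_top_of_nonneg (by norm_num) hQ)⟩

/-- **Size of the nonlinearity**: `‖|ξ|(F(s) ∗ G(s))(ξ)‖ ≤ |ξ| (qnorm F)^{1/2} (qnorm G)^{1/2}`
(Cauchy–Schwarz), for trajectories of finite norm. [folklore] -/
theorem norm_nl_le (hF : Measurable (uncurry F)) (hG : Measurable (uncurry G))
    (hQF : qnorm T F ≠ ∞) (hQG : qnorm T G ≠ ∞) {s : ℝ} (hs : s ∈ Icc (0 : ℝ) T) (ξ : ℝ³) :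
    ‖nl F G s ξ‖ ≤ ‖ξ‖ * (qnorm T F ^ (1 / 2 : ℝ) * qnorm T G ^ (1 / 2 : ℝ)).toReal := by
  rw [nl, norm_mul, Complex.norm_real, Real.norm_of_nonneg (norm_nonneg _)]
  refine mul_le_mul_of_nonneg_left ?_ (norm_nonneg _)
  have h := enorm_fconv_le (measurable_slice hF s).aestronglyMeasurable
    (measurable_slice hG s).aestronglyMeasurable ξ
  have h2 : ‖fconv (F s) (G s) ξ‖ₑ ≤ qnorm T F ^ (1 / 2 : ℝ) * qnorm T G ^ (1 / 2 : ℝ) :=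
    h.trans (mul_le_mul' (eLpNorm_slice_le F hs) (eLpNorm_slice_le G hs))
  have hfin : qnorm T F ^ (1 / 2 : ℝ) * qnorm T G ^ (1 / 2 : ℝ) ≠ ∞ :=
    ENNReal.mul_ne_top (ENNReal.rpow_ne_top_of_nonneg (by norm_num) hQF)
      (ENNReal.rpow_ne_top_of_nonneg (by norm_num) hQG)
  refine (ENNReal.ofReal_le_iff_le_toReal hfin).1 ?_
  rwa [ofReal_norm]

/-- **The Duhamel integrand is integrable in time** on `[0, t] ⊆ [0, T]` for trajectories of
finite norm (bounded and measurable). [folklore] -/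
theorem intervalIntegrable_heat_smul_nl (hν : 0 ≤ ν) (hF : Measurable (uncurry F))
    (hG : Measurable (uncurry G)) (hQF : qnorm T F ≠ ∞) (hQG : qnorm T G ≠ ∞) {t : ℝ}
    (ht : t ∈ Icc (0 : ℝ) T) (ξ : ℝ³) :
    IntervalIntegrable (fun s => heat ν ξ (t - s) • nl F G s ξ) volume 0 t := by
  rw [intervalIntegrable_iff_integrableOn_Ioc_of_le ht.1]
  have hh : Continuous fun s : ℝ => heat ν ξ (t - s) := by
    simp only [heat]
    fun_prop
  have hn : Measurable fun s => nl F G s ξ := measurable_tslice (measurable_nl_uncurry hF hG) ξ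
  have hm : Measurable fun s => heat ν ξ (t - s) • nl F G s ξ := hh.measurable.smul hn
  refine IntegrableOn.of_bound measure_Ioc_lt_top hm.aestronglyMeasurable
    (‖ξ‖ * (qnorm T F ^ (1 / 2 : ℝ) * qnorm T G ^ (1 / 2 : ℝ)).toReal) ?_
  refine (ae_restrict_iff' measurableSet_Ioc).2 (Eventually.of_forall fun s hs => ?_)
  rw [norm_smul, Real.norm_of_nonneg (heat_nonneg _ _ _)]
  calc heat ν ξ (t - s) * ‖nl F G s ξ‖ ≤ 1 * ‖nl F G s ξ‖ :=
        mul_le_mul_of_nonneg_right (heat_le_one hν (sub_nonneg.2 hs.2) ξ) (norm_nonneg _)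
    _ ≤ _ := by rw [one_mul]; exact norm_nl_le hF hG hQF hQG ⟨hs.1.le, hs.2.trans ht.2⟩ ξ

/-- Additivity of the nonlinearity in the first slot (finite norms). [folklore] -/
theorem nl_sub_left (hF : Measurable (uncurry F)) (hF' : Measurable (uncurry F'))
    (hG : Measurable (uncurry G)) (hQF : qnorm T F ≠ ∞) (hQF' : qnorm T F' ≠ ∞)
    (hQG : qnorm T G ≠ ∞) {s : ℝ} (hs : s ∈ Icc (0 : ℝ) T) (ξ : ℝ³) :
    nl (F - F') G s ξ = nl F G s ξ - nl F' G s ξ := by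
  simp only [nl]
  rw [← mul_sub, show (F - F') s = F s - F' s from rfl,
    fconv_sub_left (integrable_fconv_integrand (memLp_slice hF hQF hs) (memLp_slice hG hQG hs) ξ)
      (integrable_fconv_integrand (memLp_slice hF' hQF' hs) (memLp_slice hG hQG hs) ξ)]

/-- Additivity of the nonlinearity in the second slot (finite norms). [folklore] -/
theorem nl_sub_right (hF : Measurable (uncurry F)) (hG : Measurable (uncurry G))
    (hG' : Measurable (uncurry G')) (hQF : qnorm T F ≠ ∞) (hQG : qnorm T G ≠ ∞)
    (hQG' : qnorm T G' ≠ ∞) {s : ℝ} (hs : s ∈ Icc (0 : ℝ) T) (ξ : ℝ³) :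
    nl F (G - G') s ξ = nl F G s ξ - nl F G' s ξ := by
  simp only [nl]
  rw [← mul_sub, show (G - G') s = G s - G' s from rfl,
    fconv_sub_right (integrable_fconv_integrand (memLp_slice hF hQF hs) (memLp_slice hG hQG hs) ξ)
      (integrable_fconv_integrand (memLp_slice hF hQF hs) (memLp_slice hG' hQG' hs) ξ)]

/-- **Bilinearity of `bilin`, first slot**, on the window, for trajectories of finite norm.
[folklore] -/
theorem bilin_sub_left (hν : 0 ≤ ν) (hF : Measurable (uncurry F)) (hF' : Measurable (uncurry F'))
    (hG : Measurable (uncurry G)) (hQF : qnorm T F ≠ ∞) (hQF' : qnorm T F' ≠ ∞)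
    (hQG : qnorm T G ≠ ∞) {t : ℝ} (ht : t ∈ Icc (0 : ℝ) T) (ξ : ℝ³) :
    bilin ν T (F - F') G t ξ = bilin ν T F G t ξ - bilin ν T F' G t ξ := by
  rw [bilin_of_mem _ _ ht, bilin_of_mem _ _ ht, bilin_of_mem _ _ ht,
    ← intervalIntegral.integral_sub (intervalIntegrable_heat_smul_nl hν hF hG hQF hQG ht ξ)
      (intervalIntegrable_heat_smul_nl hν hF' hG hQF' hQG ht ξ)]
  refine intervalIntegral.integral_congr fun s hs => ?_
  rw [uIcc_of_le ht.1] at hs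
  rw [nl_sub_left hF hF' hG hQF hQF' hQG ⟨hs.1, hs.2.trans ht.2⟩ ξ, smul_sub]

/-- **Bilinearity of `bilin`, second slot**, on the window, for trajectories of finite norm.
[folklore] -/
theorem bilin_sub_right (hν : 0 ≤ ν) (hF : Measurable (uncurry F)) (hG : Measurable (uncurry G))
    (hG' : Measurable (uncurry G')) (hQF : qnorm T F ≠ ∞) (hQG : qnorm T G ≠ ∞)
    (hQG' : qnorm T G' ≠ ∞) {t : ℝ} (ht : t ∈ Icc (0 : ℝ) T) (ξ : ℝ³) :
    bilin ν T F (G - G') t ξ = bilin ν T F G t ξ - bilin ν T F G' t ξ := by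
  rw [bilin_of_mem _ _ ht, bilin_of_mem _ _ ht, bilin_of_mem _ _ ht,
    ← intervalIntegral.integral_sub (intervalIntegrable_heat_smul_nl hν hF hG hQF hQG ht ξ)
      (intervalIntegrable_heat_smul_nl hν hF hG' hQF hQG' ht ξ)]
  refine intervalIntegral.integral_congr fun s hs => ?_
  rw [uIcc_of_le ht.1] at hs
  rw [nl_sub_right hF hG hG' hQF hQG hQG' ⟨hs.1, hs.2.trans ht.2⟩ ξ, smul_sub]

/-- **The difference of two quadratic Duhamel terms**:
`bilin(F,F) - bilin(G,G) = bilin(F - G, F) + bilin(G, F - G)` on the window (finite norms of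
`F` and `G` suffice) — the identity behind the contraction estimate. [folklore] -/
theorem bilin_self_sub_self (hν : 0 ≤ ν) (hF : Measurable (uncurry F))
    (hG : Measurable (uncurry G)) (hQF : qnorm T F ≠ ∞) (hQG : qnorm T G ≠ ∞)
    {t : ℝ} (ht : t ∈ Icc (0 : ℝ) T) (ξ : ℝ³) :
    bilin ν T F F t ξ - bilin ν T G G t ξ =
      bilin ν T (F - G) F t ξ + bilin ν T G (F - G) t ξ := by
  rw [bilin_sub_left hν hF hG hF hQF hQG hQF ht ξ,
    bilin_sub_right hν hG hF hG hQG hQF hQG ht ξ]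
  ring

end Linearity

end CheapNS

end Literature.Barriers.NavierStokesRegularity

end
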